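import Summits.Ventures.Crystal3D.Theorems.StickyWulffConstantPolycrystalWulffBoundTwoClassBallCut
import Summits.Ventures.Crystal3D.Theorems.StickyWulffConstantPolycrystalWulffBoundTwoClassOneArith
import Summits.Ventures.Crystal3D.Theorems.StickyWulffConstantPolycrystalWulffBoundGenericTwoGrainElevenTenths

/-!
# `PolycrystalWulffBound`, line `PolyDensity`: the TWO-LATTICE twin-free rung AT THE CRUX'S OWN CHARGE
# `c₀ = 1`, UNCONDITIONALLY — and the generic two-grain named fact `GenericTwoGrainInequality 1` as a
# THEOREM (crux `stmt-Ventures-19482`; lane poly-p2, gen 24)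

Route `StickyWulffConstant` of the venture `Summits/Ventures/Crystal3D`, second prover lane.  Until this
file the two-lattice generic class of the v4 crux was a kernel theorem only modulo the certificate CH-P1
(`WulffOverlap27_5`, kit j292055; `rung_twinFree_twoClasses_of_WulffOverlap27_5`,
`genericTwoGrainInequality_of_WulffOverlap27_5`), or certificate-free from charge `11/10` upwards
(`…RungTwinFreeChargedSharp`).  The NEW ROW is the BALL CUT of `…TwoClassBallCut`: the symmetric convex
body `L = W_D ∩ B̄(0,2)` lies in the dominant class's body and is charged at most `2` on the satellites'
free facets, so `3·|L|^{1/3}|E|^{2/3} ≤ per_L(E) ≤ F_D + 2·Y` with `|L| ≥ π(24√3 − 32) = 30.06` (tree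
lemmas only: `per_iUnion_le_freeEnergy`, `wulff_le_per`, `volume_cruxWulffBody_inter_closedBall_two_ge`).
With it the two-class LP closes at charge `1` on the whole range of the satellite fraction
`σ = s/Vol ∈ (0, 1/2]`:

* `σ ≤ 3/20`        — dominant corner, `rung_dominantTwinFree` (poly-p2 g3);
* `3/20 ≤ σ ≤ 1/4`  — MID BAND (new): energy split + per-class Wulff bounds of both classes + inradius
  bound + ball cut, concavity chords in `σ`, `midBand_arith_one` (margin `0.29 %`);
* `1/4 ≤ σ ≤ 1/2`   — balanced corner: intersection body `|W₁ ∩ W₂| ≥ 26.61` (`wulffPairOverlap_cap`,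
  unconditional) against the second pincer, `twoClass_arith_one` (margin `0.33 %`).

Results:
* `rung_twinFree_twoClasses_one` : **twin-free polyhedral crux textures with at most two lattice classes
  satisfy the polycrystal Wulff bound — at the crux's own wall law (generic charge `≥ 1` from the texture
  clause), with NO certificate and NO named fact**;
* `genericTwoGrainInequality_one_le` / `genericTwoGrainInequality_one` : **lane P's generic two-grain
  named fact `GenericTwoGrainInequality c` is a THEOREM for every `c ≥ 1`** (supersedes
  `genericTwoGrainInequality_of_WulffOverlap27_5`, p755294, which assumed CH-P1);
* `twoLatticeClassV4_unconditional` : the two-lattice generic class of `stmt-Ventures-19482` BY NAME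
  (texture clause verbatim), unconditionally (`twoLatticeClassV4_of_genericTwoGrainInequality`, p708761).

LADDER of the all-generic class after this file: two lattices — **`c₀ = 1` (the crux text),
certificate-free** (was: mod CH-P1; certificate-free only from `11/10`); any number of lattices —
unchanged (`c₀ = 1` mod CH-P1′ + `AggCert27_8`; certificate-free from `3/2`).  Necessary `c₀ ≥ √5 − √3`
(paper).
WHAT THIS IS NOT: anything about three or more lattice classes at charge `1`, twins, or V5's `13/25`;
the crux is not claimed.
-/

noncomputable section

open scoped BigOperators InnerProductSpace ENNReal
open MeasureTheory Filter Finset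

namespace Summit.Ventures.Crystal3D.Cruxes.PolycrystalWulffBound.PolyDensity

open Summit.Ventures.Crystal3D.Theorems
open Summit.Ventures.Crystal3D.Cruxes.TextureLiminf.TexShadow (per polytope E3)
open Literature.MathematicalPhysics.StatisticalMechanics (perimeter)

/-! ### Two lattice classes at the crux's charge `1` -/

/-- **Twin-free polyhedral crux textures with at most two lattice classes satisfy the polycrystal Wulff
bound — at the crux's own wall law, unconditionally.**  Dominant corner (`≥ 17/20`, g3) / mid band
(`[3/4, 17/20)`, ball cut) / balanced (both classes `≥ 1/4`, overlap `26.61`). -/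
theorem rung_twinFree_twoClasses_one :
    let Λ : Set (EuclideanSpace ℝ (Fin 3)) := Literature.MathematicalPhysics.StatisticalMechanics.fccStacking 1 (Real.sqrt (2 / 3));
    let Brl : (ℤ → ℤ) → Set (EuclideanSpace ℝ (Fin 3)) := Literature.MathematicalPhysics.StatisticalMechanics.barlowStacking 1 (Real.sqrt (2 / 3));
    let Ax : EuclideanSpace ℝ (Fin 3) → (EuclideanSpace ℝ (Fin 3) ≃ₗᵢ[ℝ] EuclideanSpace ℝ (Fin 3)) → (EuclideanSpace ℝ (Fin 3) ≃ₗᵢ[ℝ] EuclideanSpace ℝ (Fin 3)) → Prop := fun m A B => ∃ (L : EuclideanSpace ℝ (Fin 3) ≃ₗᵢ[ℝ] EuclideanSpace ℝ (Fin 3)) (s₁ s₂ : EuclideanSpace ℝ (Fin 3)) (σ σ' : ℤ → ℤ), Literature.MathematicalPhysics.StatisticalMechanics.IsHaggSeq σ ∧ Literature.MathematicalPhysics.StatisticalMechanics.IsHaggSeq σ' ∧ L (EuclideanSpace.single (2 : Fin 3) (1 : ℝ)) = m ∧ A '' Λ ⊆ (fun q => L q + s₁) '' Brl σ ∧ B ''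 Λ ⊆ (fun q => L q + s₂) '' Brl σ';
    let CoAx : (EuclideanSpace ℝ (Fin 3) ≃ₗᵢ[ℝ] EuclideanSpace ℝ (Fin 3)) → (EuclideanSpace ℝ (Fin 3) ≃ₗᵢ[ℝ] EuclideanSpace ℝ (Fin 3)) → Prop := fun A B => ∃ m, Ax m A B;
    let Φ : EuclideanSpace ℝ (Fin 3) → ℝ := fun ν => Real.sqrt 2 / 4 * ∑ᶠ w ∈ {w ∈ Λ | ‖w‖ = 1}, |⟪w, ν⟫_ℝ|;
    let Per : Set (EuclideanSpace ℝ (Fin 3)) → Set (EuclideanSpace ℝ (Fin 3)) → ℝ := fun K S => (⨆ (ξ : EuclideanSpace ℝ (Fin 3) → EuclideanSpace ℝ (Fin 3)) (_ : ContDiff ℝ 1 ξ ∧ HasCompactSupport ξ ∧ ∀ z, ξ z ∈ K), ENNReal.ofReal (∫ z in S, Literature.MathematicalPhysics.StatisticalMechanics.fieldDivergence ξ z)).toReal;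
    let ι : Set (EuclideanSpace ℝ (Fin 3)) → Set (EuclideanSpace ℝ (Fin 3)) → Set (EuclideanSpace ℝ (Fin 3)) → ℝ := fun K S₁ S₂ => (Per K S₁ + Per K S₂ - Per K (S₁ ∪ S₂)) / 2;
    let W : (EuclideanSpace ℝ (Fin 3) ≃ₗᵢ[ℝ] EuclideanSpace ℝ (Fin 3)) → Set (EuclideanSpace ℝ (Fin 3)) := fun A => {y | ∀ ν : EuclideanSpace ℝ (Fin 3), ⟪y, ν⟫_ℝ ≤ Φ (A.symm ν)};
    let Dsc : EuclideanSpace ℝ (Fin 3) → Set (EuclideanSpace ℝ (Fin 3)) := fun m => {y | ‖y‖ ≤ 1 ∧ ⟪y, m⟫_ℝ = 0};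
    let Tex : (n : ℕ) → (Fin n → Set (EuclideanSpace ℝ (Fin 3))) → (Fin n → (EuclideanSpace ℝ (Fin 3) ≃ₗᵢ[ℝ] EuclideanSpace ℝ (Fin 3))) → (Fin n → Fin n → ℝ) → (Fin n → Fin n → EuclideanSpace ℝ (Fin 3)) → Prop := fun n G A c m => (∀ f : Fin n, Literature.MathematicalPhysics.StatisticalMechanics.HasFinitePerimeter (G f) ∧ volume (G f) < ⊤) ∧ (∀ f g, f ≠ g → Disjoint (G f) (G g)) ∧ (∀ f g, f ≠ g → 0 ≤ c f g) ∧ (∀ f g, f ≠ g → ¬ CoAx (A f) (A g) → m f g = 0 ∧ 1 ≤ c f g) ∧ (∀ f g, f ≠ g → CoAx (A f) (A g) → A f '' Λ ≠ A g '' Λ → Ax (m f g) (A f) (A g) ∧ 1 / 2 ≤ c f g);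
    let En : (n : ℕ) → (Fin n → Set (EuclideanSpace ℝ (Fin 3))) → (Fin n → (EuclideanSpace ℝ (Fin 3) ≃ₗᵢ[ℝ] EuclideanSpace ℝ (Fin 3))) → (Fin n → Fin n → ℝ) → (Fin n → Fin n → EuclideanSpace ℝ (Fin 3)) → ℝ := fun n G A c m => ∑ f : Fin n, Per (W (A f)) (G f) - ∑ f, ∑ g, (if f = g then 0 else ι (W (A f)) (G f) (G g)) + ∑ f, ∑ g, (if f = g then 0 else c f g / 2 * ι (Dsc (m f g)) (G f) (G g));
    let Vol : (n : ℕ) → (Fin n → Set (EuclideanSpace ℝ (Fin 3))) → ℝ := fun n G => (volume (⋃ f : Fin n, G f)).toReal;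
    let Poly : Set (EuclideanSpace ℝ (Fin 3)) → Prop := fun S => ∃ (k : ℕ) (H : Fin k → Finset ((EuclideanSpace ℝ (Fin 3)) × ℝ)), S = ⋃ i, ⋂ p ∈ H i, {x | ⟪p.1, x⟫_ℝ < p.2};
    let TF : (n : ℕ) → (Fin n → (EuclideanSpace ℝ (Fin 3) ≃ₗᵢ[ℝ] EuclideanSpace ℝ (Fin 3))) → Prop := fun n A => ∀ f g : Fin n, f ≠ g → CoAx (A f) (A g) → A f '' Λ = A g '' Λ;
    ∀ (n : ℕ) (G : Fin n → Set (EuclideanSpace ℝ (Fin 3))) (A : Fin n → (EuclideanSpace ℝ (Fin 3) ≃ₗᵢ[ℝ] EuclideanSpace ℝ (Fin 3))) (c : Fin n → Fin n → ℝ) (m : Fin n → Fin n → EuclideanSpace ℝ (Fin 3)), Tex n G A c m → (∀ f, Poly (G f)) → TF n A → (∀ f g h : Fin n, A f '' Λ = A g '' Λ ∨ A g '' Λ = A h '' Λ ∨ A f '' Λ = A h '' Λ) → 6 * (2 : ℝ) ^ ((1 : ℝ) / 3) * (Real.sqrt 2 * Vol n G) ^ ((2 : ℝ) / 3) ≤ En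 n G A c m := by
  intro Λ Brl Ax CoAx Φ Per ι W Dsc Tex En Vol Poly TF n G A c m hTex hPoly hTF hTwo
  have hCh : ∀ f g : Fin n, f ≠ g → ¬ CoAx (A f) (A g) → (1 : ℝ) ≤ c f g :=
    fun f g hfg hnc => (hTex.2.2.2.1 f g hfg hnc).2
  by_cases hdom : ∃ f₀ : Fin n, 17 / 20 * Vol n G ≤ (volume (⋃ g ∈ {g : Fin n | A g '' Λ = A f₀ '' Λ}, G g)).toReal
  · exact rung_dominantTwinFree n G A c m hTex hPoly hTF hdom
  by_cases hmid : ∃ f₀ : Fin n, 3 / 4 * Vol n G ≤ (volume (⋃ g ∈ {g : Fin n | A g '' Λ = A f₀ '' Λ}, G g)).toReal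
  · -- MID BAND: the class of `f₀` carries between `3/4` and `17/20` of the volume
    obtain ⟨f₀, hf₀⟩ := hmid
    have hf₀' : (volume (⋃ g ∈ {g : Fin n | A g '' Λ = A f₀ '' Λ}, G g)).toReal ≤ 17 / 20 * Vol n G := by
      by_contra h
      exact hdom ⟨f₀, le_of_lt (not_le.1 h)⟩
    obtain ⟨vD, s, FD, FS, Y, A₁, -, hs0, hY0, hA0, hV, hvDeq, hα, hβ, hγ, hδ, hε⟩ :=
      twinFree_twoClass_ballCut_rows 1 n G A c m f₀ hTex hPoly hTF hTwo zero_le_one hCh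
    rw [← hvDeq] at hf₀ hf₀'
    exact midBand_arith_one hV hs0 hf₀ hf₀' hY0 hA0 (by linarith) hβ hγ hδ hε
  -- BALANCED: every class carries less than `3/4` of the volume
  classical
  obtain ⟨D, hD0, hP1, hP2, hP3, hV⟩ := twinFree_pincers_charged 1 n G A c m hTex hPoly hTF hCh
  -- lattice classes and their volumes
  set lat : Fin n → Set E3 := fun f => A f '' Λ with hlat
  set L : Finset (Set E3) := Finset.univ.image lat with hL
  set v : Set E3 → ℝ := fun ℓ =>
    (volume (⋃ f ∈ Finset.univ.filter (fun f => lat f = ℓ), G f)).toReal with hv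
  have hset : ∀ f₀, (⋃ f ∈ Finset.univ.filter (fun f => lat f = lat f₀), G f) =
      ⋃ g ∈ {g : Fin n | A g '' Λ = A f₀ '' Λ}, G g := by
    intro f₀
    ext x
    simp only [Set.mem_iUnion, Finset.mem_filter, Finset.mem_univ, true_and, Set.mem_setOf_eq,
      exists_prop, hlat]
  have hlt : ∀ f₀, v (lat f₀) < 3 / 4 * Vol n G := by
    intro f₀
    by_contra h
    exact hmid ⟨f₀, by rw [← hset f₀]; exact not_lt.1 h⟩
  have hVnn : 0 ≤ Vol n G := ENNReal.toReal_nonneg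
  have hV' : Vol n G = ∑ ℓ ∈ L, v ℓ := hV
  -- no grains: trivial
  rcases isEmpty_or_nonempty (Fin n) with hn | ⟨⟨f₁⟩⟩
  · -- no grains: `Vol = 0` and the energy is `≥ 0` by the first pincer
    have hL0 : L = ∅ := by
      rw [hL]; exact Finset.image_eq_empty.2 (Finset.univ_eq_empty_iff.2 hn)
    have hV0 : Vol n G = 0 := by rw [hV', hL0, Finset.sum_empty]
    have hP1' : Real.sqrt 3 * (perimeter (⋃ f, G f)).toReal + 1 / 2 * D ≤ En n G A c m := hP1
    have hP0 : 0 ≤ (perimeter (⋃ f, G f)).toReal := ENNReal.toReal_nonneg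
    have h3 : 0 ≤ Real.sqrt 3 := Real.sqrt_nonneg 3
    rw [hV0, mul_zero, Real.zero_rpow (by norm_num), mul_zero]
    nlinarith [mul_nonneg h3 hP0]
  -- a second class exists
  obtain ⟨f₂, hne⟩ : ∃ f₂, lat f₂ ≠ lat f₁ := by
    by_contra hall
    push Not at hall
    have hL1 : L = {lat f₁} := by
      ext ℓ
      simp only [hL, Finset.mem_image, Finset.mem_univ, true_and, Finset.mem_singleton]
      exact ⟨fun ⟨f, hf⟩ => hf ▸ hall f, fun h => ⟨f₁, h.symm⟩⟩
    have hV1 : Vol n G = v (lat f₁) := by rw [hV', hL1, Finset.sum_singleton]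
    have := hlt f₁
    rw [← hV1] at this
    linarith
  have hL2 : L = {lat f₁, lat f₂} := by
    ext ℓ
    simp only [hL, Finset.mem_image, Finset.mem_univ, true_and, Finset.mem_insert,
      Finset.mem_singleton]
    constructor
    · rintro ⟨f, rfl⟩
      rcases hTwo f f₁ f₂ with h | h | h
      · exact Or.inl h
      · exact absurd h.symm hne
      · exact Or.inr h
    · rintro (h | h)
      · exact ⟨f₁, h.symm⟩
      · exact ⟨f₂, h.symm⟩
  have hne' : lat f₁ ≠ lat f₂ := fun h => hne h.symm
  have hV2 : Vol n G = v (lat f₁) + v (lat f₂) := by rw [hV', hL2, Finset.sum_pair hne']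
  have hb1 : 1 / 4 * Vol n G ≤ v (lat f₁) := by have := hlt f₂; linarith
  have hb2 : 1 / 4 * Vol n G ≤ v (lat f₂) := by have := hlt f₁; linarith
  -- the intersection body of the two classes
  have hWc : ∀ f, IsCompact (W (A f)) := fun f => isCompact_cruxWulffBody (A f)
  have hWv : ∀ f, Convex ℝ (W (A f)) := fun f => convex_cruxWulffBody (A f)
  have hW0 : ∀ f, (0 : E3) ∈ W (A f) := fun f => zero_mem_cruxWulffBody (A f)
  have hWs : ∀ f, -W (A f) = W (A f) := fun f => neg_cruxWulffBody_eq (A f)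
  have hWeq : ∀ f g, lat f = lat g → W (A f) = W (A g) := fun f g h => wulffBody_eq_of_image_eq h
  set K : Set E3 := W (A f₁) ∩ W (A f₂) with hK
  have hKsub : ∀ f, K ⊆ W (A f) := by
    intro f
    rcases hTwo f f₁ f₂ with h | h | h
    · rw [hWeq f f₁ h]; exact Set.inter_subset_left
    · exact absurd h.symm hne
    · rw [hWeq f f₂ h]; exact Set.inter_subset_right
  have hKvol : (26.61 : ℝ) ≤ (volume K).toReal := volume_cruxWulffBody_inter_ge_cap (A f₁) (A f₂)
  have hInter : 3 * (volume K).toReal ^ ((1 : ℝ) / 3) * (Vol n G) ^ ((2 : ℝ) / 3) + 1 / 2 * D ≤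
      En n G A c m :=
    hP3 K ((hWc f₁).inter (hWc f₂)) ((hWv f₁).inter (hWv f₂)) ⟨hW0 f₁, hW0 f₂⟩
      (by rw [hK, Set.inter_neg, hWs f₁, hWs f₂]) hKsub
  -- the two bounds and the arithmetic
  have hP2' : (∑ ℓ ∈ L, 6 * (2 : ℝ) ^ ((1 : ℝ) / 3) * (Real.sqrt 2 * v ℓ) ^ ((2 : ℝ) / 3)) -
      (Real.sqrt 5 - 1 / 2) * D ≤ En n G A c m := hP2
  have hP' : 6 * (2 : ℝ) ^ ((1 : ℝ) / 3) * (Real.sqrt 2 * v (lat f₁)) ^ ((2 : ℝ) / 3) +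
      6 * (2 : ℝ) ^ ((1 : ℝ) / 3) * (Real.sqrt 2 * v (lat f₂)) ^ ((2 : ℝ) / 3) -
      (Real.sqrt 5 - 1 / 2) * D ≤ En n G A c m := by
    rw [hL2, Finset.sum_pair hne'] at hP2'
    linarith
  exact twoClass_arith_one hV2 hb1 hb2 hKvol hD0 hInter hP'

/-! ### The generic two-grain named fact at `c ≥ 1`, unconditionally -/

/-- **`GenericTwoGrainInequality c` for every `c ≥ 1`, unconditionally** (supersedes
`genericTwoGrainInequality_of_WulffOverlap27_5`, p755294, which assumed CH-P1): the two-grain texture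
`![S₁, S₂]` with frames `![A, B]`, all charges `c` and all axes `0` is a crux texture whose only distinct
pair is generic and charged `c ≥ 1`; `rung_twinFree_twoClasses_one` applied to it is, after unfolding the
`n = 2` sums, the conclusion of `GenericTwoGrainInequality c`.  No certificate, no named fact. -/
theorem genericTwoGrainInequality_one_le {c : ℝ} (hc : 1 ≤ c) :
    GenericTwoGrainInequality c := by
  unfold GenericTwoGrainInequality
  intro Λ Brl Ax CoAx Φ Per ι W Dsc Poly A B hAB S₁ S₂ hP₁ hP₂ hv₁ hv₂ hd
  classical
  -- the two-grain texture
  set G : Fin 2 → Set E3 := ![S₁, S₂] with hG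
  set A' : Fin 2 → (E3 ≃ₗᵢ[ℝ] E3) := ![A, B] with hA'
  have hG0 : G 0 = S₁ := rfl
  have hG1 : G 1 = S₂ := rfl
  have hA0 : A' 0 = A := rfl
  have hA1 : A' 1 = B := rfl
  have h01 : (0 : Fin 2) ≠ 1 := by decide
  have hc1 : (1 : ℝ) ≤ c := hc
  -- co-axiality is symmetric
  have hCoAx_symm : ∀ (X Y : E3 ≃ₗᵢ[ℝ] E3), CoAx X Y → CoAx Y X := by
    intro X Y hXY
    obtain ⟨m, L, s₁, s₂, σ, σ', hσ, hσ', hL, h1, h2⟩ := hXY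
    exact ⟨m, L, s₂, s₁, σ', σ, hσ', hσ, hL, h2, h1⟩
  -- no distinct pair of the texture is co-axial
  have hnc : ∀ f g : Fin 2, f ≠ g → ¬ CoAx (A' f) (A' g) := by
    intro f g hfg
    fin_cases f <;> fin_cases g
    · exact absurd rfl hfg
    · exact hAB
    · exact fun h => hAB (hCoAx_symm _ _ h)
    · exact absurd rfl hfg
  -- the texture clause
  have hTex : (∀ f : Fin 2, Literature.MathematicalPhysics.StatisticalMechanics.HasFinitePerimeter (G f) ∧
        volume (G f) < ⊤) ∧
      (∀ f g : Fin 2, f ≠ g → Disjoint (G f) (G g)) ∧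
      (∀ f g : Fin 2, f ≠ g → (0 : ℝ) ≤ (fun _ _ : Fin 2 => c) f g) ∧
      (∀ f g : Fin 2, f ≠ g → ¬ CoAx (A' f) (A' g) →
        (fun _ _ : Fin 2 => (0 : E3)) f g = 0 ∧ (1 : ℝ) ≤ (fun _ _ : Fin 2 => c) f g) ∧
      (∀ f g : Fin 2, f ≠ g → CoAx (A' f) (A' g) → A' f '' Λ ≠ A' g '' Λ →
        Ax ((fun _ _ : Fin 2 => (0 : E3)) f g) (A' f) (A' g) ∧ (1 : ℝ) / 2 ≤ (fun _ _ : Fin 2 => c) f g) := by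
    refine ⟨?_, ?_, ?_, ?_, ?_⟩
    · intro f
      fin_cases f
      · exact ⟨hasFinitePerimeter_of_poly hP₁ hv₁, hv₁⟩
      · exact ⟨hasFinitePerimeter_of_poly hP₂ hv₂, hv₂⟩
    · intro f g hfg
      fin_cases f <;> fin_cases g
      · exact absurd rfl hfg
      · exact hd
      · exact hd.symm
      · exact absurd rfl hfg
    · intro f g _
      show (0 : ℝ) ≤ c
      linarith
    · intro f g _ _
      exact ⟨rfl, hc1⟩
    · intro f g hfg hco _
      exact absurd hco (hnc f g hfg)
  have hPoly : ∀ f : Fin 2, Poly (G f) := by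
    intro f
    fin_cases f
    · exact hP₁
    · exact hP₂
  have hTF : ∀ f g : Fin 2, f ≠ g → CoAx (A' f) (A' g) → A' f '' Λ = A' g '' Λ :=
    fun f g hfg hco => absurd hco (hnc f g hfg)
  have hTwo : ∀ f g h : Fin 2, A' f '' Λ = A' g '' Λ ∨ A' g '' Λ = A' h '' Λ ∨ A' f '' Λ = A' h '' Λ := by
    intro f g h
    fin_cases f <;> fin_cases g <;> fin_cases h <;> simp
  -- the two-class rung (charge `1`) on the two-grain texture
  have key : 6 * (2 : ℝ) ^ ((1 : ℝ) / 3) * (Real.sqrt 2 * (volume (⋃ f : Fin 2, G f)).toReal) ^ ((2 : ℝ) / 3) ≤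
      ∑ f : Fin 2, Per (W (A' f)) (G f) -
        ∑ f : Fin 2, ∑ g : Fin 2, (if f = g then 0 else ι (W (A' f)) (G f) (G g)) +
        ∑ f : Fin 2, ∑ g : Fin 2,
          (if f = g then 0 else (fun _ _ : Fin 2 => c) f g / 2 *
            ι (Dsc ((fun _ _ : Fin 2 => (0 : E3)) f g)) (G f) (G g)) :=
    rung_twinFree_twoClasses_one 2 G A' (fun _ _ => c) (fun _ _ => (0 : E3))
      hTex hPoly hTF hTwo
  -- unfold the `n = 2` sums
  have hU : (⋃ f : Fin 2, G f) = S₁ ∪ S₂ := by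
    ext x
    simp only [Set.mem_iUnion, Fin.exists_fin_two, hG0, hG1, Set.mem_union]
  have hEn : (∑ f : Fin 2, Per (W (A' f)) (G f) -
        ∑ f : Fin 2, ∑ g : Fin 2, (if f = g then 0 else ι (W (A' f)) (G f) (G g)) +
        ∑ f : Fin 2, ∑ g : Fin 2,
          (if f = g then 0 else (fun _ _ : Fin 2 => c) f g / 2 *
            ι (Dsc ((fun _ _ : Fin 2 => (0 : E3)) f g)) (G f) (G g))) =
      (Per (W A) S₁ - ι (W A) S₁ S₂) + (Per (W B) S₂ - ι (W B) S₂ S₁) + c * ι (Dsc 0) S₁ S₂ := by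
    simp only [ι, Fin.sum_univ_two, Fin.isValue, if_true, if_false, h01, h01.symm, hG0, hG1, hA0, hA1,
      Set.union_comm S₂ S₁]
    ring
  rw [hU, hEn] at key
  exact key

/-- **Lane P's generic two-grain named fact at the crux's wall constant `1` is a theorem.** -/
theorem genericTwoGrainInequality_one : GenericTwoGrainInequality 1 :=
  genericTwoGrainInequality_one_le le_rfl

/-- **The two-lattice generic class of the v4 crux `PolycrystalWulffBound` BY NAME, unconditionally**
(texture clause of `stmt-Ventures-19482` verbatim): every v4 crux texture with polyhedral grains drawn from
two non-co-axial lattices satisfies the crux energy bound (`twoLatticeClassV4_of_genericTwoGrainInequality`,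
p708761, fed with `genericTwoGrainInequality_one`). -/
theorem twoLatticeClassV4_unconditional :
    let Λ : Set (EuclideanSpace ℝ (Fin 3)) := Literature.MathematicalPhysics.StatisticalMechanics.fccStacking 1 (Real.sqrt (2 / 3));
    let Brl : (ℤ → ℤ) → Set (EuclideanSpace ℝ (Fin 3)) := Literature.MathematicalPhysics.StatisticalMechanics.barlowStacking 1 (Real.sqrt (2 / 3));
    let Ax : EuclideanSpace ℝ (Fin 3) → (EuclideanSpace ℝ (Fin 3) ≃ₗᵢ[ℝ] EuclideanSpace ℝ (Fin 3)) → (EuclideanSpace ℝ (Fin 3) ≃ₗᵢ[ℝ] EuclideanSpace ℝ (Fin 3)) → Prop := fun m A B => ∃ (L : EuclideanSpace ℝ (Fin 3) ≃ₗᵢ[ℝ] EuclideanSpace ℝ (Fin 3)) (s₁ s₂ : EuclideanSpace ℝ (Fin 3)) (σ σ' : ℤ → ℤ), Literature.MathematicalPhysics.StatisticalMechanics.IsHaggSeq σ ∧ Literature.MathematicalPhysics.StatisticalMechanics.IsHaggSeq σ' ∧ L (EuclideanSpace.single (2 : Fin 3) (1 : ℝ)) = m ∧ A '' Λ ⊆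 (fun q => L q + s₁) '' Brl σ ∧ B '' Λ ⊆ (fun q => L q + s₂) '' Brl σ';
    let CoAx : (EuclideanSpace ℝ (Fin 3) ≃ₗᵢ[ℝ] EuclideanSpace ℝ (Fin 3)) → (EuclideanSpace ℝ (Fin 3) ≃ₗᵢ[ℝ] EuclideanSpace ℝ (Fin 3)) → Prop := fun A B => ∃ m, Ax m A B;
    let Φ : EuclideanSpace ℝ (Fin 3) → ℝ := fun ν => Real.sqrt 2 / 4 * ∑ᶠ w ∈ {w ∈ Λ | ‖w‖ = 1}, |⟪w, ν⟫_ℝ|;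
    let Per : Set (EuclideanSpace ℝ (Fin 3)) → Set (EuclideanSpace ℝ (Fin 3)) → ℝ := fun K S => (⨆ (ξ : EuclideanSpace ℝ (Fin 3) → EuclideanSpace ℝ (Fin 3)) (_ : ContDiff ℝ 1 ξ ∧ HasCompactSupport ξ ∧ ∀ z, ξ z ∈ K), ENNReal.ofReal (∫ z in S, Literature.MathematicalPhysics.StatisticalMechanics.fieldDivergence ξ z)).toReal;
    let ι : Set (EuclideanSpace ℝ (Fin 3)) → Set (EuclideanSpace ℝ (Fin 3)) → Set (EuclideanSpace ℝ (Fin 3)) → ℝ := fun K S₁ S₂ => (Per K S₁ + Per K S₂ - Per K (S₁ ∪ S₂)) / 2;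
    let W : (EuclideanSpace ℝ (Fin 3) ≃ₗᵢ[ℝ] EuclideanSpace ℝ (Fin 3)) → Set (EuclideanSpace ℝ (Fin 3)) := fun A => {y | ∀ ν : EuclideanSpace ℝ (Fin 3), ⟪y, ν⟫_ℝ ≤ Φ (A.symm ν)};
    let Dsc : EuclideanSpace ℝ (Fin 3) → Set (EuclideanSpace ℝ (Fin 3)) := fun m => {y | ‖y‖ ≤ 1 ∧ ⟪y, m⟫_ℝ = 0};
    let Tex : (n : ℕ) → (Fin n → Set (EuclideanSpace ℝ (Fin 3))) → (Fin n → (EuclideanSpace ℝ (Fin 3) ≃ₗᵢ[ℝ] EuclideanSpace ℝ (Fin 3))) → (Fin n → Fin n → ℝ) → (Fin n → Fin n → EuclideanSpace ℝ (Fin 3)) → Prop := fun n G A c m => (∀ f : Fin n, Literature.MathematicalPhysics.StatisticalMechanics.HasFinitePerimeter (G f) ∧ volume (G f) < ⊤) ∧ (∀ f g, f ≠ g → Disjoint (G f) (G g)) ∧ (∀ f g, f ≠ g → 0 ≤ c f g) ∧ (∀ f g, f ≠ g → ¬ CoAx (A f) (A g) → m f g = 0 ∧ 1 ≤ c f g)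 ∧ (∀ f g, f ≠ g → CoAx (A f) (A g) → A f '' Λ ≠ A g '' Λ → Ax (m f g) (A f) (A g) ∧ 1 / 2 ≤ c f g);
    let En : (n : ℕ) → (Fin n → Set (EuclideanSpace ℝ (Fin 3))) → (Fin n → (EuclideanSpace ℝ (Fin 3) ≃ₗᵢ[ℝ] EuclideanSpace ℝ (Fin 3))) → (Fin n → Fin n → ℝ) → (Fin n → Fin n → EuclideanSpace ℝ (Fin 3)) → ℝ := fun n G A c m => ∑ f : Fin n, Per (W (A f)) (G f) - ∑ f, ∑ g, (if f = g then 0 else ι (W (A f)) (G f) (G g)) + ∑ f, ∑ g, (if f = g then 0 else c f g / 2 * ι (Dsc (m f g)) (G f) (G g));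
    let Vol : (n : ℕ) → (Fin n → Set (EuclideanSpace ℝ (Fin 3))) → ℝ := fun n G => (volume (⋃ f : Fin n, G f)).toReal;
    let Poly : Set (EuclideanSpace ℝ (Fin 3)) → Prop := fun S => ∃ (k : ℕ) (H : Fin k → Finset ((EuclideanSpace ℝ (Fin 3)) × ℝ)), S = ⋃ i, ⋂ p ∈ H i, {x | ⟪p.1, x⟫_ℝ < p.2};
    ∀ (n : ℕ) (G : Fin n → Set (EuclideanSpace ℝ (Fin 3)))
      (A : Fin n → (EuclideanSpace ℝ (Fin 3) ≃ₗᵢ[ℝ] EuclideanSpace ℝ (Fin 3)))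
      (c : Fin n → Fin n → ℝ) (mm : Fin n → Fin n → EuclideanSpace ℝ (Fin 3))
      (A₀ B₀ : EuclideanSpace ℝ (Fin 3) ≃ₗᵢ[ℝ] EuclideanSpace ℝ (Fin 3)),
      ¬ CoAx A₀ B₀ → Tex n G A c mm → (∀ f, Poly (G f)) →
      (∀ f, A f '' Λ = A₀ '' Λ ∨ A f '' Λ = B₀ '' Λ) →
      6 * (2 : ℝ) ^ ((1 : ℝ) / 3) * (Real.sqrt 2 * Vol n G) ^ ((2 : ℝ) / 3) ≤ En n G A c mm :=
  twoLatticeClassV4_of_genericTwoGrainInequality genericTwoGrainInequality_one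

end Summit.Ventures.Crystal3D.Cruxes.PolycrystalWulffBound.PolyDensity

end
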